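import Literature.Barriers.RiemannHypothesis.EpsteinZetaRealZerosPairGrouping
import HarnessLib

/-!
# Low's grouping for `d = 408`: `L(σ, χ_{−d}) > 0` on `(0, 1)` by pairing the principal class

Barrier audit (D-0021) of `Literature.Barriers.RiemannHypothesis.EpsteinZetaRealZeros`, continued
(generation 9, 2026-08-27): instances of `EpsteinZetaRealZerosPairGrouping.lean`. Everything here is
PROVED (theorems only).

* `d = 408` (`h(−408) = 4`, reduced classes `(1, 0, 102)`, `(2, 0, 51)`, `(3, 0, 34)`, `(6, 0, 17)`; the principal class of
  height `√408/2 = 10.100…` is grouped with `(6, 0, 17)` of height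
  `√408/12 = 1.683…`, the other classes are negative on their own):
  `re_Λ_pair_neg_408`, `LFunction_re_pos_of_odd_quadratic_408`, `LFunction_ne_zero_of_odd_quadratic_408`
  (15 cells, Bessel allowance `β₂ = 3/125`).

`χ_{−408}` has no order-two Fekete–Pólya certificate along an induced character of modulus `≤ 7·10⁴`
(integer scan of this seat, 2026-08-27); the grouped Epstein class sum replaces a long higher-order walk.

## Proof shape (per discriminant)

`keyIneq_d` is the elementary inequality of `pair_cell` on finitely many cells in `u = 2σ − 1`
(rational data `Y_i ≥ y_i`, `X_i`, `ρ` with the integer-power certificates `Y_i^k ≤ X_i^n`,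
`ρ^n ≤ (1/a₂)^k` decided by `norm_num`), with an extra margin
`δ₀` on the cells next to `u = 0` that feeds the continuity argument at `σ = ½`;
`re_Λ_pair_neg_d` combines it with the analytic core `re_Λ_add_re_Λ_lt_of_key` and
`re_add_re_neg_of_Ioo_half_one`; `LFunction_re_pos_of_odd_quadratic_d` is `LFunction_re_pos_of_pair`
with the two reduced classes written out (discriminant by `norm_num`, reducedness and primitivity by
`decide`).

## References

* [Low1968] M. E. Low, Acta Arith. 14 (1968) 117–140, Theorem 5 (via MR 38#4425).
* [Watkins2004RealZeros] M. Watkins, Math. Comp. 73 (2004) 415–423, Theorem (p. 416): no real zero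
  on `(0, ∞)` for every odd real primitive character of conductor `≤ 3·10⁸` — the three characters
  here are instances, now kernel-checked.
-/

noncomputable section

open Complex Filter Topology MeasureTheory Set HurwitzZeta
open scoped UpperHalfPlane

namespace Literature.Barriers.RiemannHypothesis

open Literature.NumberTheory.Automorphic
open Literature.NumberTheory.LFunctions.RealZeros
open Literature.NumberTheory.QuadraticFields.BinaryQuadraticForm (discr_apply)

/-- **The key inequality for `d = 408`** (heights `y₁ = √408/2`, `y₂ = √408/12`;
`M = 47/1000`, allowances `β₁ + β₂ = 1 / 40` and the margin `δ₀ = 1 / 200` on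
`u ≤ 1 / 20`), by 15 cells of `pair_cell` (tightest rational check
`1.9952 ≤ 2`). [folklore] -/
private theorem keyIneq_408 {y₁ y₂ u : ℝ} (hy1 : y₁ = Real.sqrt 408 / 2)
    (hy2 : y₂ = Real.sqrt 408 / 12)
    (hu0 : 0 < u) (hu1 : u < 1) :
    (47 / 1000 - 1 / (1 + u) + 1 / u) * (y₁ ^ ((1 + u) / 2) + y₂ ^ ((1 + u) / 2)) +
      (47 / 1000 - 1 / (1 - u) - 1 / u +
          (1 / 40 + if u ≤ 1 / 20 then (1 / 200 : ℝ) else 0)) *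
        (y₁ ^ ((1 - u) / 2) + y₂ ^ ((1 - u) / 2)) ≤ 0 := by
  have hS : Real.sqrt 408 ≤ 20.19902 := by
    rw [Real.sqrt_le_left (by norm_num)]; norm_num
  have hS' : (20.19 : ℝ) ≤ Real.sqrt 408 := by
    rw [Real.le_sqrt (by norm_num) (by norm_num)]; norm_num
  have hy2one : 1 ≤ y₂ := by rw [hy2, le_div_iff₀ (by norm_num)]; linarith
  have h12 : y₂ ≤ y₁ := by
    rw [hy1, hy2]; exact div_le_div_of_nonneg_left (Real.sqrt_nonneg _) (by norm_num) (by norm_num)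
  have hr : y₂ = (1 / 6 : ℝ) * y₁ := by rw [hy1, hy2]; ring
  have hY1 : y₁ ≤ 10.09951 := by rw [hy1]; linarith
  have hY2 : y₂ ≤ 1.68327 := by rw [hy2, div_le_iff₀ (by norm_num)]; linarith
  have cell : ∀ (p q X₁ X₂ ρ β : ℝ) (kq nq ke ne : ℕ), nq ≠ 0 → q * nq = kq →
      (10.09951 : ℝ) ^ kq ≤ X₁ ^ nq → (1.68327 : ℝ) ^ kq ≤ X₂ ^ nq → 0 ≤ X₂ → X₂ ≤ X₁ →
      0 < ρ → ne ≠ 0 → (1 - p) / 2 * ne = ke → ρ ^ ne ≤ (1 / 6 : ℝ) ^ ke →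
      p ≤ u → u ≤ q → 0 ≤ β →
      (1 - p) * (((X₁ + ρ * X₂) / (1 + ρ) - 1) / q +
        (1 + q) * (47 / 1000 * ((X₁ + ρ * X₂) / (1 + ρ) + 1) + β)) ≤ 2 →
      (47 / 1000 - 1 / (1 + u) + 1 / u) * (y₁ ^ ((1 + u) / 2) + y₂ ^ ((1 + u) / 2)) +
        (47 / 1000 - 1 / (1 - u) - 1 / u + β) * (y₁ ^ ((1 - u) / 2) + y₂ ^ ((1 - u) / 2)) ≤
          0 :=
    fun p q X₁ X₂ ρ β kq nq ke ne hnq hq' hX1 hX2 hX20 hX21 hρ0 hne he hρ hp hq hβ hc =>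
      pair_cell hy2one h12 hr (by norm_num) hY1 hY2 hnq hq' hX1 hX2 hX20 hX21 hρ0 hne he hρ hp hu0
        hq hu1 (by norm_num) hβ hc
  split_ifs with hδ
  · -- `u ≤ 1 / 20`: the cells carrying the margin `δ₀`
    rcases le_or_gt u (1 / 40) with hc0 | hc0
    · exact cell (0) (1 / 40) 1.0597 1.0133 0.4081 (1 / 40 + 1 / 200) 1 40 1 2
        (by norm_num) (by norm_num) (by norm_num) (by norm_num) (by norm_num) (by norm_num)
        (by norm_num) (by norm_num) (by norm_num) (by norm_num) hu0.le hc0 (by norm_num) (by norm_num)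
    exact cell (1 / 40) (1 / 20) 1.1227 1.0265 0.4173 (1 / 40 + 1 / 200) 1 20 39 80
        (by norm_num) (by norm_num) (by norm_num) (by norm_num) (by norm_num) (by norm_num)
        (by norm_num) (by norm_num) (by norm_num) (by norm_num) hc0.le hδ (by norm_num) (by norm_num)
  · -- `1 / 20 < u < 1`
    have hδ' : (1 / 20 : ℝ) < u := lt_of_not_ge hδ
    rcases le_or_gt u (3 / 40) with hc0 | hc0
    · exact cell (1 / 20) (3 / 40) 1.1895 1.04 0.4268 (1 / 40 + 0) 3 40 19 40
        (by norm_num) (by norm_num) (by norm_num) (by norm_num) (by norm_num) (by norm_num)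
        (by norm_num) (by norm_num) (by norm_num) (by norm_num) hδ'.le hc0 (by norm_num) (by norm_num)
    rcases le_or_gt u (1 / 10) with hc1 | hc1
    · exact cell (3 / 40) (1 / 10) 1.2603 1.0536 0.4365 (1 / 40 + 0) 1 10 37 80
        (by norm_num) (by norm_num) (by norm_num) (by norm_num) (by norm_num) (by norm_num)
        (by norm_num) (by norm_num) (by norm_num) (by norm_num) hc0.le hc1 (by norm_num) (by norm_num)
    rcases le_or_gt u (1 / 8) with hc2 | hc2
    · exact cell (1 / 10) (1 / 8) 1.3353 1.0674 0.4464 (1 / 40 + 0) 1 8 9 20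
        (by norm_num) (by norm_num) (by norm_num) (by norm_num) (by norm_num) (by norm_num)
        (by norm_num) (by norm_num) (by norm_num) (by norm_num) hc1.le hc2 (by norm_num) (by norm_num)
    rcases le_or_gt u (3 / 20) with hc3 | hc3
    · exact cell (1 / 8) (3 / 20) 1.4148 1.0814 0.4565 (1 / 40 + 0) 3 20 7 16
        (by norm_num) (by norm_num) (by norm_num) (by norm_num) (by norm_num) (by norm_num)
        (by norm_num) (by norm_num) (by norm_num) (by norm_num) hc2.le hc3 (by norm_num) (by norm_num)
    rcases le_or_gt u (1 / 5) with hc4 | hc4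
    · exact cell (3 / 20) (1 / 5) 1.5882 1.1099 0.4668 (1 / 40 + 0) 1 5 17 40
        (by norm_num) (by norm_num) (by norm_num) (by norm_num) (by norm_num) (by norm_num)
        (by norm_num) (by norm_num) (by norm_num) (by norm_num) hc3.le hc4 (by norm_num) (by norm_num)
    rcases le_or_gt u (1 / 4) with hc5 | hc5
    · exact cell (1 / 5) (1 / 4) 1.7828 1.1392 0.4882 (1 / 40 + 0) 1 4 2 5
        (by norm_num) (by norm_num) (by norm_num) (by norm_num) (by norm_num) (by norm_num)
        (by norm_num) (by norm_num) (by norm_num) (by norm_num) hc4.le hc5 (by norm_num) (by norm_num)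
    rcases le_or_gt u (3 / 10) with hc6 | hc6
    · exact cell (1 / 4) (3 / 10) 2.0013 1.1692 0.5106 (1 / 40 + 0) 3 10 3 8
        (by norm_num) (by norm_num) (by norm_num) (by norm_num) (by norm_num) (by norm_num)
        (by norm_num) (by norm_num) (by norm_num) (by norm_num) hc5.le hc6 (by norm_num) (by norm_num)
    rcases le_or_gt u (7 / 20) with hc7 | hc7
    · exact cell (3 / 10) (7 / 20) 2.2466 1.2001 0.534 (1 / 40 + 0) 7 20 7 20
        (by norm_num) (by norm_num) (by norm_num) (by norm_num) (by norm_num) (by norm_num)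
        (by norm_num) (by norm_num) (by norm_num) (by norm_num) hc6.le hc7 (by norm_num) (by norm_num)
    rcases le_or_gt u (2 / 5) with hc8 | hc8
    · exact cell (7 / 20) (2 / 5) 2.522 1.2317 0.5584 (1 / 40 + 0) 2 5 13 40
        (by norm_num) (by norm_num) (by norm_num) (by norm_num) (by norm_num) (by norm_num)
        (by norm_num) (by norm_num) (by norm_num) (by norm_num) hc7.le hc8 (by norm_num) (by norm_num)
    rcases le_or_gt u (1 / 2) with hc9 | hc9
    · exact cell (2 / 5) (1 / 2) 3.1781 1.2976 0.584 (1 / 40 + 0) 1 2 3 10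
        (by norm_num) (by norm_num) (by norm_num) (by norm_num) (by norm_num) (by norm_num)
        (by norm_num) (by norm_num) (by norm_num) (by norm_num) hc8.le hc9 (by norm_num) (by norm_num)
    rcases le_or_gt u (13 / 20) with hc10 | hc10
    · exact cell (1 / 2) (13 / 20) 4.4958 1.403 0.6388 (1 / 40 + 0) 13 20 1 4
        (by norm_num) (by norm_num) (by norm_num) (by norm_num) (by norm_num) (by norm_num)
        (by norm_num) (by norm_num) (by norm_num) (by norm_num) hc9.le hc10 (by norm_num) (by norm_num)
    rcases le_or_gt u (17 / 20) with hc11 | hc11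
    · exact cell (13 / 20) (17 / 20) 7.1394 1.5569 0.7307 (1 / 40 + 0) 17 20 7 40
        (by norm_num) (by norm_num) (by norm_num) (by norm_num) (by norm_num) (by norm_num)
        (by norm_num) (by norm_num) (by norm_num) (by norm_num) hc10.le hc11 (by norm_num) (by norm_num)
    exact cell (17 / 20) (1) 10.09951 1.68327 0.8741 (1 / 40 + 0) 1 1 3 40
        (by norm_num) (by norm_num) (by norm_num) (by norm_num) (by norm_num) (by norm_num)
        (by norm_num) (by norm_num) (by norm_num) (by norm_num) hc11.le hu1.le (by norm_num) (by norm_num)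

/-- **`Re Λ_{z₁}(σ) + Re Λ_{z₂}(σ) < 0` on `(0, 1)` for the two classes of discriminant `−408`**
(`Im z₁ = √408/2`, the principal class, whose own `Λ` is positive near `σ = ½`;
`Im z₂ = √408/12`). [cite: Low1968, Theorem 5 (via MR 38#4425)] -/
theorem re_Λ_pair_neg_408 (z₁ z₂ : ℍ) (h1 : z₁.im = Real.sqrt 408 / 2)
    (h2 : z₂.im = Real.sqrt 408 / 12) {σ : ℝ} (hσ0 : 0 < σ) (hσ1 : σ < 1) :
    ((thetaFEPair z₁).Λ σ).re + ((thetaFEPair z₂).Λ σ).re < 0 := by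
  have hS : Real.sqrt 408 ≤ 20.19902 := by
    rw [Real.sqrt_le_left (by norm_num)]; norm_num
  have hS' : (20.19 : ℝ) ≤ Real.sqrt 408 := by
    rw [Real.le_sqrt (by norm_num) (by norm_num)]; norm_num
  have hy2 : 1 ≤ z₂.im := by rw [h2, le_div_iff₀ (by norm_num)]; linarith
  have h21 : z₂.im ≤ z₁.im := by
    rw [h1, h2]; exact div_le_div_of_nonneg_left (Real.sqrt_nonneg _) (by norm_num) (by norm_num)
  have hE1 : 48 * Real.sqrt z₁.im * Real.exp (-(7 / 5) * Real.pi * z₁.im) ≤ 2 * (1 / 1000) :=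
    bessel_allowance_of_three_le (by rw [h1]; linarith) (by rw [h1]; linarith)
  have hE2 : 48 * Real.sqrt z₂.im * Real.exp (-(7 / 5) * Real.pi * z₂.im) ≤ 2 * (3 / 125) := by
    have hπ := Real.pi_gt_d6
    have hy0 : 0 < z₂.im := z₂.im_pos
    have hylo : (1.682 : ℝ) ≤ z₂.im := by rw [h2, le_div_iff₀ (by norm_num)]; linarith
    have hyhi : z₂.im ≤ 1.684 := by rw [h2, div_le_iff₀ (by norm_num)]; linarith
    have he1 := Real.exp_one_gt_d9
    have h6 : (2.7182818283 : ℝ) ^ 6 ≤ Real.exp 6 := by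
      rw [show (6 : ℝ) = (6 : ℕ) * 1 by norm_num, Real.exp_nat_mul]
      exact pow_le_pow_left₀ (by norm_num) he1.le 6
    have hf : (1 + 1.3978 / 4 : ℝ) ^ 4 ≤ Real.exp 1.3978 := by
      rw [show (1.3978 : ℝ) = (4 : ℕ) * (1.3978 / 4) by norm_num, Real.exp_nat_mul]
      exact pow_le_pow_left₀ (by norm_num) (by linarith [Real.add_one_le_exp (1.3978 / 4 : ℝ)]) 4
    have hL : (1337.8 : ℝ) ≤ Real.exp 7.3978 := by
      rw [show (7.3978 : ℝ) = 6 + 1.3978 by norm_num, Real.exp_add]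
      calc (1337.8 : ℝ) ≤ 2.7182818283 ^ 6 * (1 + 1.3978 / 4) ^ 4 := by norm_num
        _ ≤ Real.exp 6 * Real.exp 1.3978 := mul_le_mul h6 hf (by positivity) (Real.exp_pos _).le
    have hexp : Real.exp (-(7 / 5) * Real.pi * z₂.im) ≤ 1 / 1337.8 := by
      have h1 : Real.exp (-(7 / 5) * Real.pi * z₂.im) ≤ Real.exp (-7.3978) :=
        Real.exp_le_exp.2 (by nlinarith)
      rw [Real.exp_neg, ← one_div] at h1
      exact h1.trans (one_div_le_one_div_of_le (by norm_num) hL)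
    have hs : Real.sqrt z₂.im ≤ 1.2978 := by
      refine (Real.sqrt_le_sqrt hyhi).trans ?_
      rw [Real.sqrt_le_left (by norm_num)]; norm_num
    calc 48 * Real.sqrt z₂.im * Real.exp (-(7 / 5) * Real.pi * z₂.im) ≤ 48 * 1.2978 * (1 / 1337.8) :=
          mul_le_mul (mul_le_mul_of_nonneg_left hs (by norm_num)) hexp (Real.exp_pos _).le
            (by positivity)
      _ ≤ _ := by norm_num
  -- the margin on `(½, 1)`, uniform near `½`
  have hmain : ∀ τ : ℝ, 1 / 2 < τ → τ < 1 → ((thetaFEPair z₁).Λ τ).re + ((thetaFEPair z₂).Λ τ).re <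
      -(4 * (if 2 * τ - 1 ≤ (1 / 20 : ℝ) then (1 / 200 : ℝ) else 0)) := by
    intro τ hτ hτ1
    have hu0 : 0 < 2 * τ - 1 := by linarith
    have hu1 : 2 * τ - 1 < 1 := by linarith
    have hk := keyIneq_408 h1 h2 hu0 hu1
    rw [show (1 + (2 * τ - 1)) / 2 = τ by ring, show (1 - (2 * τ - 1)) / 2 = 1 - τ by ring] at hk
    refine re_Λ_add_re_Λ_lt_of_key z₁ z₂ hy2 h21 hτ hτ1 (β₁ := 1 / 1000) (β₂ := 3 / 125)
      (by norm_num) (by norm_num) (by split_ifs <;> norm_num) hE1 hE2 ?_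
    convert hk using 3; ring
  refine re_add_re_neg_of_Ioo_half_one z₁ z₂ (c := 4 * (1 / 200 : ℝ)) (ε := 1 / 40)
    (by norm_num) (by norm_num) (fun τ hτ hτ1 => ?_) (fun τ hτ hτ1 => ?_) hσ0 hσ1
  · have h := hmain τ hτ hτ1
    have h0 : (0 : ℝ) ≤ 4 * (if 2 * τ - 1 ≤ (1 / 20 : ℝ) then (1 / 200 : ℝ) else 0) := by
      split_ifs <;> norm_num
    linarith
  · have h := hmain τ hτ (by linarith)
    rw [if_pos (by linarith)] at h
    exact h.le

/-- **`Re L(σ, χ) > 0` on all of `(0, 1)` for the odd real primitive character mod `408`**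
(`h(−408) = 4`; the principal class `(1, 0, 102)` grouped with `(6, 0, 17)`,
the remaining classes negative on their own): Low's grouping of the principal
class with the class `(6, 0, 17)`. In particular `L(s, χ_{−408})` has no real zero in `(0, 1)`.
[cite: Watkins2004RealZeros, Theorem (p. 416)] -/
theorem LFunction_re_pos_of_odd_quadratic_408 {χ : DirichletCharacter ℂ 408} (hprim : χ.IsPrimitive)
    (hquad : χ.IsQuadratic) (hodd : χ.Odd) {σ : ℝ} (hσ0 : 0 < σ) (hσ1 : σ < 1) :
    0 < (χ.LFunction σ).re := by
  refine LFunction_re_pos_of_pair (d := 408) (b₁ := 0) (c₁ := 102) (a₂ := 6) (b₂ := 0)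
    (c₂ := 17) (by norm_num) (by norm_num) hprim hquad hodd (by rw [discr_apply]; norm_num)
    (by decide) (by rw [discr_apply]; norm_num) (by decide) (by decide) (by norm_num) ?_ hσ0 hσ1
  intro Z₁ Z₂ hZ1 hZ2 τ hτ0 hτ1
  push_cast at hZ1 hZ2
  refine pair_re_neg_of_Λ (a₁ := 1) (b₁ := 0) (c₁ := 102) (a₂ := 6) (b₂ := 0) (c₂ := 17)
    ⟨by norm_num, by norm_num⟩ ⟨by norm_num, by norm_num⟩ (by norm_num) ?_ hZ1 hZ2 hτ0 hτ1
  intro z₁ z₂ hz1 hz2 σ' hσ'0 hσ'1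
  have e1 : z₁.im = Real.sqrt 408 / 2 := by rw [hz1, starkK]; norm_num
  have e2 : z₂.im = Real.sqrt 408 / 12 := by rw [hz2, starkK]; norm_num
  exact re_Λ_pair_neg_408 z₁ z₂ e1 e2 hσ'0 hσ'1

/-- **No real zero of `L(s, χ_{−408})` in `(0, 1)`.** [cite: Watkins2004RealZeros, Theorem (p. 416)] -/
theorem LFunction_ne_zero_of_odd_quadratic_408 {χ : DirichletCharacter ℂ 408} (hprim : χ.IsPrimitive)
    (hquad : χ.IsQuadratic) (hodd : χ.Odd) {σ : ℝ} (hσ0 : 0 < σ) (hσ1 : σ < 1) :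
    χ.LFunction σ ≠ 0 := by
  intro h0
  have h := LFunction_re_pos_of_odd_quadratic_408 hprim hquad hodd hσ0 hσ1
  rw [h0, Complex.zero_re] at h
  exact lt_irrefl _ h

end Literature.Barriers.RiemannHypothesis
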